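import Summits.ResolutionOfSingularities.ResolutionOfSingularities.Theorems.FrobeniusLadderFRationalResolutionFixedPointResolution
import Summits.ResolutionOfSingularities.ResolutionOfSingularities.Theorems.FrobeniusLadderFRationalResolutionFixedPointSameDegreeParameters
import HarnessLib

/-!
# Crux `FrobeniusLadder.FRationalResolution` (stmt-ResolutionOfSingularities-15317), line `redirect`,
# stub `stub_diagonalizableQuotientResolution` — the Veronese-type sub-class of the stub's hypothesis `hq`, DISCHARGED in the stub's own
# frame (regular graded chart algebra `S`, étale `Spec S₀ → X`; intrinsic degree test; no parameters to supply)

`…FixedPointResolution.hasResolution_of_isolated_sameDegree_fixedPoints` (p840922) asks the consumer for homogeneous regular parameters of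
one degree; `…FixedPointSameDegreeParameters.exists_sameDegree_parameters_of_fixed` (p840954) produces them from the stub's data (`S`
REGULAR) and the intrinsic test «homogeneous elements of `𝔔` of degree `≠ a₀` lie in `𝔪²_{S_𝔔}`». Composition:

* ★★★★★★ `hasResolution_of_isolated_veroneseType_fixedPoints` — `X` integral, locally of finite type over a field `k`, finitely many
  singular points, each the image under an étale `φ : Spec S₀ → X` — `S` a REGULAR algebra of finite type over a field `k'` graded by a
  torsion abelian group `A` (as in `hq`) — of the contraction of a `D(A)`-fixed prime `𝔔` at which, for some `a₀ : A`, every homogeneous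
  element of `𝔔` of degree `≠ a₀` maps into `𝔪²_{S_𝔔}`. Then `X` has a resolution of singularities.

E.g. `S = k'[y₁,…,y_n]` with `deg yᵢ = 1 ∈ ℤ/r` and `𝔔 = (y)` (cyclic quotient singularities `1/r(1,…,1)` and their twisted forms, every
characteristic). Honest label: a sub-class of ONE leaf stub closed unconditionally; the stub, crux and summit are not closed. No
definitions, no named facts, no sorry. [cite: Kollar2007, §2.2] [cite: Kato1994, Thm. (3.2)] [cite: Matsumura1987, Thm. 2.3; Thm. 14.2]
-/

noncomputable section

-- single-problem summit: the doubled namespace component is forced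
set_option linter.dupNamespace false

open CategoryTheory AlgebraicGeometry TopologicalSpace IsLocalRing
open Literature.AlgebraicGeometry.Resolution

namespace Summit.ResolutionOfSingularities.ResolutionOfSingularities.Theorems.FRationalResolution.FixedPointResolution

/-- ★★★★★★ **RESOLUTION FOR ISOLATED QUOTIENT POINTS OF VERONESE TYPE, in the frame of `stub_diagonalizableQuotientResolution`.**
`X` integral, locally of finite type over a field `k`, with finitely many singular points, each the image under an étale
`φ : Spec S₀ → X` (`S` REGULAR of finite type over a field `k'`, graded by a torsion abelian group `A`, `S₀ = 𝒮 0`) of the contraction of a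
`D(A)`-fixed prime `𝔔` such that, for some `a₀`, every homogeneous element of `𝔔` of degree `≠ a₀` maps into `𝔪²_{S_𝔔}`. Then `X` has a
resolution of singularities. [cite: Kollar2007, §2.2] [cite: Kato1994, Thm. (3.2)] [cite: Matsumura1987, Thm. 2.3; Thm. 14.2] -/
theorem hasResolution_of_isolated_veroneseType_fixedPoints (k : Type) [Field k] (X : Scheme.{0}) [IsIntegral X]
    (f : X ⟶ Spec (.of k)) [LocallyOfFiniteType f] (hfin : (Scheme.regularLocus X)ᶜ.Finite)
    (hchart : ∀ t : X, t ∉ Scheme.regularLocus X →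
      ∃ (k' : Type) (_ : Field k') (A : Type) (_ : DecidableEq A) (_ : AddCommGroup A) (_ : AddMonoid.IsTorsion A)
        (S : Type) (_ : CommRing S) (_ : Algebra k' S) (𝒮 : A → Submodule k' S) (_ : GradedAlgebra 𝒮)
        (_ : Algebra.FiniteType k' S) (_ : IsRegularRing S) (φ : Spec (.of (𝒮 0)) ⟶ X) (_ : Etale φ)
        (𝔔 : Ideal S) (_ : 𝔔.IsPrime) (_ : ∀ a : A, a ≠ 0 → ∀ s ∈ 𝒮 a, s ∈ 𝔔) (a₀ : A),
        (∀ a : A, a ≠ a₀ → ∀ s ∈ 𝒮 a, s ∈ 𝔔 →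
          algebraMap S (Localization.AtPrime 𝔔) s ∈ (maximalIdeal (Localization.AtPrime 𝔔)) ^ 2) ∧
        φ ⟨𝔔.comap (algebraMap (𝒮 0) S), inferInstance⟩ = t) :
    Scheme.HasResolution X := by
  refine hasResolution_of_isolated_sameDegree_fixedPoints k X f hfin fun t ht => ?_
  obtain ⟨k', _, A, _, _, hA, S, _, _, 𝒮, _, _, _, φ, hφ, 𝔔, _, hfix, a₀, hdeg, hφt⟩ := hchart t ht
  obtain ⟨n, x, hxa, hspan, hn⟩ :=
    FixedPointSameDegreeParameters.exists_sameDegree_parameters_of_fixed 𝒮 𝔔 hfix a₀ hdeg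
  exact ⟨k', inferInstance, A, inferInstance, inferInstance, hA, S, inferInstance, inferInstance, 𝒮, inferInstance,
    inferInstance, φ, hφ, 𝔔, inferInstance, hfix, n, x, a₀, hxa, hspan, hn, hφt⟩

end Summit.ResolutionOfSingularities.ResolutionOfSingularities.Theorems.FRationalResolution.FixedPointResolution

end
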